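import Summits.BirchSwinnertonDyer.BirchSwinnertonDyer.Theorems.SignedLowerHalvesSmallImageLowerHalfBothSignsRttCharRoadCurveAssembly
import HarnessLib

/-!
# Route `SignedLowerHalves`, crux L `SmallImageLowerHalfBothSigns` (item stmt-BirchSwinnertonDyer-23599), line `rtt_w3` v9 —
# row J-curve, the LOCAL α-statement `αloc` from LEVEL DATA (any non-archimedean local field `F`, valuative integers `𝒪[F]`)

Width seat `bsd-line-slh-p3-w3` g16 under LEAD `cruxlead-stmt-BirchSwinnertonDyer-23599`; helper `--supports stmt-BirchSwinnertonDyer-23599`;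
THEOREMS ONLY, no `sorry`; closes nothing; BSD / crux L / J-curve / E1 / E2 are NOT proved by any of this.

WHY. The K_v-specific assembly `exists_alpha_of_levels` (`…RttCharRoadCurveAssembly.lean`, p762293) produces the α-half of `hJcurve`
directly (target `K_v ⧸ 𝒪_v·1`, scalar `e_v(χ_π δ)`). The hand building the level data (honda g18: Stage A p762036 division points of `F_g`,
Stage B p762479 torsion points of `W ⊗ F`, file `…RttCharRoadCurveLevels.lean`) works over a GENERAL local field `F ⊇ ℚ_p` with
`#𝓀(F) = p²` and closes with the LOCAL shape `αloc` (target `F ⧸ 𝒪[F]·1`, scalar `χ_π(δ) ∈ 𝒪[F]`), which `alphaHalf_of_alphaLoc`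
(`…RttCharRoadCurveTransport.lean`, p762440) then carries to `hJcurve`. THIS file is the generic-`F` twin of the assembly:

* `mem_span_integer_one_iff` — `x ∈ 𝒪[F]·1 ↔ x ∈ 𝒪[F]`;
* ★★ `exists_alphaLoc_of_levels` — level maps `φ_n : 𝒪[F] →+ T` with (i) kernel exactly `π^{n+1}`, (ii) tower compatibility up to the
  generator ambiguity (`∀ n ∃ c ∀ a, φ_n a = φ_{n+1}(c·a)`), (iii) exhaustion of `T`, (iv) `φ_n(χ_π(δ)·a) = act δ (φ_n a)` ⟹
  `∃ α : T →+ F ⧸ 𝒪[F]·1`, bijective, `α(act δ t) = χ_π(δ) • α(t)`. Proof = the three generic steps of the K_v file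
  (`exists_strict_levels_of_levels`, `exists_divisibleHom_of_strict_levels`, inversion modulo `𝒪`).

References: [LubinTate1965] Thm. 2 and Cor.; [CasselsFrohlichANT1967] Ch. VI §3.6 Prop. 6; [Kobayashi2003] §8 (proof of Thm. 8.4).
-/

set_option autoImplicit false
-- D-0017: single-problem summit, the namespace repeats the problem name by design.
set_option linter.dupNamespace false
noncomputable section

open Field Literature.NumberTheory.GaloisRepresentations

namespace Summit.BirchSwinnertonDyer.BirchSwinnertonDyer.Theorems.SmallImageRttCharRoad

section AlphaLocal

open ValuativeRel Literature.NumberTheory.GaloisRepresentations.IsNonarchimedeanLocalField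

variable {F : Type} [Field F] [ValuativeRel F] [TopologicalSpace F] [IsNonarchimedeanLocalField F]

omit [TopologicalSpace F] [IsNonarchimedeanLocalField F] in
/-- Membership in `𝒪[F]·1 ⊆ F` is membership in `𝒪[F]`. [folklore] -/
theorem mem_span_integer_one_iff (x : F) : x ∈ Submodule.span 𝒪[F] {(1 : F)} ↔ x ∈ 𝒪[F] := by
  rw [Submodule.mem_span_singleton]
  constructor
  · rintro ⟨c, rfl⟩
    rw [Algebra.smul_def, mul_one]
    exact c.2
  · intro hx
    exact ⟨⟨x, hx⟩, by rw [Algebra.smul_def, mul_one]; rfl⟩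

/-- ★★ **The LOCAL α-statement from level data** (generic local field `F`; the shape `αloc` consumed by
`alphaHalf_of_alphaLoc`). Let `T` be an additive group with an action function `act` of `Γ_F`, `π ∈ 𝒪[F]` a uniformiser with
Lubin–Tate character `χ_π`, and `φ_n : 𝒪[F] →+ T` level maps with (i) `φ_n(a) = 0 ↔ π^{n+1} ∣ a`, (ii) `∀ n ∃ c ∀ a, φ_n(a) = φ_{n+1}(c·a)`,
(iii) every `t ∈ T` is some `φ_n(a)`, (iv) `φ_n(χ_π(δ)·a) = act δ (φ_n a)`. Then there is an additive BIJECTION `α : T → F ⧸ 𝒪[F]·1` with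
`α(act δ t) = χ_π(δ) • α(t)`. For `T = (W ⊗ F)[p^∞]`, `act δ = (δ • ·)`, `π = −p` and `φ_n(a)` = the `F̄`-point of `P([a]_{g,f} λ_{n+1})`
this is `αloc`. [cite: LubinTate1965, Thm. 2 and Cor.] [cite: CasselsFrohlichANT1967, Ch. VI §3.6 Prop. 6] [cite: Kobayashi2003, §8 (proof of Thm. 8.4)] -/
theorem exists_alphaLoc_of_levels {T : Type*} [AddCommGroup T] (act : absoluteGaloisGroup F → T → T)
    {π : 𝒪[F]} (hπ : (valuation F).IsUniformizer (π : F))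
    (φ : ℕ → (𝒪[F] →+ T)) (hker : ∀ n a, φ n a = 0 ↔ π ^ (n + 1) ∣ a)
    (hcompat : ∀ n, ∃ c : 𝒪[F], ∀ a, φ n a = φ (n + 1) (c * a))
    (hsurj : ∀ t : T, ∃ (n : ℕ) (a : 𝒪[F]), φ n a = t)
    (hequiv : ∀ n (δ : absoluteGaloisGroup F) a, φ n ((lubinTateChar hπ δ : (𝒪[F])ˣ) * a) = act δ (φ n a)) :
    ∃ α : T →+ (F ⧸ Submodule.span 𝒪[F] {(1 : F)}), Function.Bijective α ∧
      ∀ (δ : absoluteGaloisGroup F) (t : T), α (act δ t) = ((lubinTateChar hπ δ : (𝒪[F])ˣ) : 𝒪[F]) • α t := by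
  -- strict data and the hull map
  obtain ⟨ψ, hkerψ, hstrict, hsurjψ, hequivψ⟩ := exists_strict_levels_of_levels hπ act
    (fun δ => ((lubinTateChar hπ δ : (𝒪[F])ˣ) : 𝒪[F])) φ hker hcompat hsurj hequiv
  obtain ⟨β, hβ⟩ := exists_divisibleHom_of_strict_levels hπ ψ hstrict
  have hπ0 : ((π : 𝒪[F]) : F) ≠ 0 := hπ.ne_zero
  set O₁ := Submodule.span 𝒪[F] {(1 : F)} with hO₁
  -- kernel of `β` is `𝒪`
  have hβker : ∀ x, β x = 0 ↔ x ∈ 𝒪[F] := by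
    intro x
    obtain ⟨n, a, ha⟩ := exists_coe_eq_pow_succ_mul hπ x
    rw [hβ n a x ha, hkerψ]
    constructor
    · rintro ⟨d, rfl⟩
      have hx : x = (d : F) := by
        have h := ha; push_cast at h
        exact (mul_left_cancel₀ (pow_ne_zero (n + 1) hπ0) h.symm)
      rw [hx]; exact d.2
    · intro hx
      refine ⟨⟨x, hx⟩, Subtype.ext ?_⟩
      push_cast; rw [ha]
  -- `β` is onto
  have hβsurj : Function.Surjective β := by
    intro t
    obtain ⟨n, a, rfl⟩ := hsurjψ t
    refine ⟨(a : F) * ((π : F) ^ (n + 1))⁻¹, hβ n a _ ?_⟩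
    rw [mul_comm, mul_assoc, inv_mul_cancel₀ (pow_ne_zero (n + 1) hπ0), mul_one]
  -- `β` is `χ_π`-equivariant
  have hβequiv : ∀ (δ : absoluteGaloisGroup F) (x : F),
      β ((((lubinTateChar hπ δ : (𝒪[F])ˣ) : 𝒪[F]) : F) * x) = act δ (β x) := by
    intro δ x
    obtain ⟨n, a, ha⟩ := exists_coe_eq_pow_succ_mul hπ x
    have ha' : ((((lubinTateChar hπ δ : (𝒪[F])ˣ) : 𝒪[F]) * a : 𝒪[F]) : F) =
        (π : F) ^ (n + 1) * ((((lubinTateChar hπ δ : (𝒪[F])ˣ) : 𝒪[F]) : F) * x) := by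
      push_cast; rw [ha]; ring
    rw [hβ n _ _ ha', hβ n a x ha, hequivψ]
  -- a section of `β` and the map `α`
  obtain ⟨s, hs⟩ := hβsurj.hasRightInverse
  have hdiff : ∀ x y, β x = β y → (Submodule.Quotient.mk x : F ⧸ O₁) = Submodule.Quotient.mk y := by
    intro x y hxy
    rw [Submodule.Quotient.eq, mem_span_integer_one_iff, ← hβker, map_sub, hxy, sub_self]
  let α : T →+ (F ⧸ O₁) := AddMonoidHom.mk' (fun t => Submodule.Quotient.mk (s t)) fun t t' => by
    show (Submodule.Quotient.mk (s (t + t')) : F ⧸ O₁) = Submodule.Quotient.mk (s t) + Submodule.Quotient.mk (s t')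
    rw [← Submodule.Quotient.mk_add]
    exact hdiff _ _ (by rw [hs, map_add, hs, hs])
  have hα : ∀ t, α t = Submodule.Quotient.mk (s t) := fun t => rfl
  have hαβ : ∀ x, α (β x) = Submodule.Quotient.mk x := fun x => by rw [hα]; exact hdiff _ _ (hs _)
  refine ⟨α, ⟨?_, ?_⟩, fun δ t => ?_⟩
  · -- injective
    refine (injective_iff_map_eq_zero α).mpr fun t ht => ?_
    rw [hα, Submodule.Quotient.mk_eq_zero, mem_span_integer_one_iff, ← hβker, hs] at ht
    exact ht
  · -- surjective
    intro q
    obtain ⟨x, rfl⟩ := Submodule.Quotient.mk_surjective O₁ q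
    exact ⟨β x, hαβ x⟩
  · -- equivariance
    obtain ⟨x, rfl⟩ := hβsurj t
    rw [← hβequiv, hαβ, hαβ, ← Submodule.Quotient.mk_smul, Algebra.smul_def]
    rfl

end AlphaLocal

end Summit.BirchSwinnertonDyer.BirchSwinnertonDyer.Theorems.SmallImageRttCharRoad

end
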